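/-
Copyright (c) 2026 the pub-hodgecm-mathlib formalisation cell (harness21).  Prover seat hodgecm-mathlib-K2-defs1 (g6), Track B, h413 = `stmt-HodgeConjecture-24833`, route `HCCMUnconditional`,
deal (277) of dealer K2E1-plan (g7) 2026-09-04T14:23:56Z («hdec at level»): the level twin of ★ K2E1-p12 `K2E1ChiMaassSelbergDecayLetterM1CMTwo`, hypothesis-first on the line symbol.
-/
import Summits.HodgeConjecture.HodgeConjecture.Theorems.K2E1KFiniteArchSmoothU2                 -- ★ (K2E1-p09): `lineSymbol_of_archConstant`, `exists_archSmooth_flatSectionU_of_lineSymbol_cm_two`; brings ★ p857911 `…_of_archSmooth`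
import Summits.HodgeConjecture.HodgeConjecture.Theorems.K2E1ChiSectionBridgeU2                  -- ★ `IsChiSection.borelLaw_flatSectionU` (the `hf` letter), `IsChiSection.toAdelic_mul` (the `hφB` letter)
import Literature.NumberTheory.Automorphic.UnitaryGroupIwasawaAdelic                           -- ★ `exists_mem_borelAdelic_mul_mem_standardMaximalCompactGL_cm` (adelic Iwasawa, CM pair)
import Literature.NumberTheory.Automorphic.UnitaryGroupLineKAverageArchSmoothTwo               -- ★ `coe_adelicVal_middleRootUnipotent_two` (`π(n b) = 1 + b E₀₁`)
import Literature.NumberTheory.Automorphic.UnitaryGroupLineUnipotentTwo                        -- ★ `middleRootUnipotent_add_two`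
import Literature.NumberTheory.NumberFields.CMFieldTotallyNegativeGenerator                    -- ★ `IsCMField.exists_complexConj_ne` (a `δ ≠ 0` with `conj δ = −δ`)
import Literature.NumberTheory.Automorphic.UnitaryGroupAdelicProduct                                     -- ★ `archPart`∕`finPart`, `archToAdelic_mul_finAdelicToAdelic`
import Summits.HodgeConjecture.HodgeConjecture.Theorems.K2E1ChiSectionSpaceU2Defs                          -- ★ row 9: `chiSectionSpace`
import HarnessLib

/-!
# `K2E1ChiMaassSelbergDecayLetterLevelCMTwo` — THE DECAY LETTER `hdec′`∕`hdec` OF THE χ-MAASS–SELBERG PAIRING AT A GENERAL LEVEL `V(χ, K′, ω)`, ON THE ARCHIMEDEAN LINE-SYMBOL LETTER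
# (the level twin of ★ `hdec'_maximalLevel_cm_two`∕`hdec_maximalLevel_cm_two`; `hφB`, `hf`, `hφU` discharged, `hφarch` from `hφsym` by ★ `exists_archSmooth_flatSectionU_of_lineSymbol_cm_two`)

Cell `pub/hodgecm-mathlib`, crux H413 = `stmt-HodgeConjecture-24833`.  THEOREMS ONLY (no `def`, no `instance`, no notation, no named-fact hypothesis, no `sorry`); lane `--supports
stmt-HodgeConjecture-24833 --as helper` (count-neutral).  Closes no socket.  WHY HYPOTHESIS-FIRST: at M1 (`χ_∞ = 1`, trivial `K_∞`-type) the section is CONSTANT along the archimedean line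
(★ `K2E1ChiSectionArchConstantLineU2.apply_eq_of_finPart_eq`), so `hφsym` is ★ `lineSymbol_of_archConstant`; for a general `(χ_∞, τ)` the line `s ↦ φ(ι(w₀)·n(θ(s,b))·k)` is a product of
one-variable ANGULAR symbols `(1 + i c s)^{n_w}(1 + c²s²)^{−n_w∕2}` (archimedean Iwasawa of `w₀ n(x)` in `SU(1,1)_w`, `χ_w`, `τ_w`), to be plugged through ★ `lineSymbol_of_prod_angular` by a
`K_∞`-type leaf NOT in the tree — so the letter stays visible here and the consumer (K2E1-p16's `…RealPolesLetterFreeLevel`) carries exactly ONE archimedean binder.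
* §1 `apply_mul_eq_of_mem_map_ofFinite` (`hφU` at level from `hU`).  * §2 HEADS **`hdec'_level_cm_two_of_lineSymbol`**, **`hdec_level_cm_two_of_lineSymbol`**.
HONEST LABEL: HC_CM is proved only modulo the 7 printed citations (2 remaining named inputs: hLiu418 = `stmt-HodgeConjecture-24832`, h413 = `stmt-HodgeConjecture-24833`) until rung 0
closes; count-neutral helper, closes no socket; the line-symbol letter `hφsym` is NOT proved here.

## References
* [MoeglinWaldspurger1995] C. Mœglin, J.-L. Waldspurger, *Spectral Decomposition and Eisenstein Series* (1995), I.2.10–I.2.13, I.2.17, II.1.5, II.1.7.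
* [Garrett2018] P. Garrett, *Modern Analysis of Automorphic Forms by Example* (2018), §2.2, §2.10.
-/

set_option autoImplicit false
set_option linter.dupNamespace false  -- the mandated namespace repeats the summit's segment (`HodgeConjecture.HodgeConjecture`)

noncomputable section

open MeasureTheory Measure NumberField NumberField.InfinitePlace NumberField.mixedEmbedding IsDedekindDomain Set Filter Topology Module
open scoped NNReal ENNReal ContDiff Classical
open Literature.NumberTheory Literature.NumberTheory.Automorphic Literature.NumberTheory.Automorphic.UnitaryGroup AdelicGroupData
open Literature.NumberTheory.GaloisRepresentations (HeckeCharacter)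
open Summit.HodgeConjecture.HodgeConjecture.Cruxes.H413.K2E1BorelEisensteinU
open Summit.HodgeConjecture.HodgeConjecture.Cruxes.H413.K2E1CharacterEisensteinU2Defs
open Summit.HodgeConjecture.HodgeConjecture.Cruxes.H413.K2E1ChiSectionSpaceU2Defs
open Summit.HodgeConjecture.HodgeConjecture.Cruxes.H413.K2E1HeightBigCellLineFormulaU2
open Summit.HodgeConjecture.HodgeConjecture.Cruxes.H413.K2E1KFiniteArchSmoothU2 (exists_archSmooth_flatSectionU_of_lineSymbol_cm_two)
open Summit.HodgeConjecture.HodgeConjecture.Cruxes.H413.K2E1EisensteinMinusConstantTermBoundedLevelCMTwo (exists_bound_sub_borelConstantTerm_level_cm_two_of_archSmooth)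

open Summit.HodgeConjecture.HodgeConjecture.Cruxes.H413.K2E1ChiSectionSpaceU2Defs

namespace Summit.HodgeConjecture.HodgeConjecture.Cruxes.H413.K2E1ChiMaassSelbergDecayLetterLevelCMTwo

variable (L : Type) [Field L] [NumberField L] [IsCMField L]
  (hij : (((0 : Fin 2) : ℕ)) + 1 = ((1 : Fin 2) : ℕ)) (hN : 2 = 2 * ((0 : Fin 2) : ℕ) + 2)

/-! ## §1 Right-invariance of a level section under an open compact `U₀`-part acting trivially -/

/-- **`hφU` AT A GENERAL LEVEL**: for `φ ∈ V(χ, K′, ω)` and an open compact `U₀ ≤ GL₂(𝔸_L^∞)` with `ι_f(U₀ ∩ G_f) ⊆ K′` on which `ω = 1`, `φ(y·u) = φ(y)` for every `u ∈ G(𝔸)` whose `GL₂`-coordinate is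
`ofFinite x`, `x ∈ U₀` (then `u = ι_f(u_f)` — archimedean component `1` — and `u_f ∈ U₀`). [cite: MoeglinWaldspurger1995, I.2.17] -/
theorem apply_mul_eq_of_mem_map_ofFinite {χ : HeckeCharacter L} {K' : Subgroup (quasiSplit (↥(maximalRealSubfield L)) L (IsCMField.complexConj L) 2).Adelic} {ωK : ↥K' → ℂ} {φ : (quasiSplit (↥(maximalRealSubfield L)) L (IsCMField.complexConj L) 2).Adelic → ℂ} (hφV : φ ∈ chiSectionSpace χ K' ωK)
    (U₀ : Subgroup (GL (Fin 2) (FiniteAdeleRing (𝓞 L) L)))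
    (hU : ∀ b : finAdelic (↥(maximalRealSubfield L)) L (IsCMField.complexConj L) 2 ((StdForm.antidiagonal 2).over L), (b : GL (Fin 2) (FiniteAdeleRing (𝓞 L) L)) ∈ U₀ →
      ∃ hb : finAdelicToAdelic (↥(maximalRealSubfield L)) L (IsCMField.complexConj L) 2 ((StdForm.antidiagonal 2).over L) b ∈ K', ωK ⟨_, hb⟩ = 1) :
    ∀ u : (quasiSplit (↥(maximalRealSubfield L)) L (IsCMField.complexConj L) 2).Adelic, adelicVal ↥(maximalRealSubfield L) L (IsCMField.complexConj L) 2 ((StdForm.antidiagonal 2).over L) u ∈ U₀.map (GLn.ofFinite 2 L) → ∀ y : (quasiSplit (↥(maximalRealSubfield L)) L (IsCMField.complexConj L) 2).Adelic, φ (y * u) = φ y := by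
  intro u hu y
  obtain ⟨x, hx, hxu⟩ := Subgroup.mem_map.1 hu
  -- `u = ι_f(u_f)` with `(u_f : GL₂) = x`
  have hfin : ((finPart (↥(maximalRealSubfield L)) L (IsCMField.complexConj L) 2 _ u : finAdelic (↥(maximalRealSubfield L)) L (IsCMField.complexConj L) 2 ((StdForm.antidiagonal 2).over L)) : GL (Fin 2) (FiniteAdeleRing (𝓞 L) L)) = x := by
    rw [coe_finPart, ← hxu, GLn.sndHom_ofFinite]
  have harch : archPart (↥(maximalRealSubfield L)) L (IsCMField.complexConj L) 2 ((StdForm.antidiagonal 2).over L) u = 1 := by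
    apply Subtype.ext
    rw [coe_archPart, ← hxu, GLn.toMixed_ofFinite, OneMemClass.coe_one]
  have hu' : u = finAdelicToAdelic (↥(maximalRealSubfield L)) L (IsCMField.complexConj L) 2 _ (finPart (↥(maximalRealSubfield L)) L (IsCMField.complexConj L) 2 _ u) := by
    conv_lhs => rw [← archToAdelic_mul_finAdelicToAdelic (↥(maximalRealSubfield L)) L (IsCMField.complexConj L) 2 ((StdForm.antidiagonal 2).over L) u, harch, map_one, one_mul]
  obtain ⟨hb, hω⟩ := hU (finPart (↥(maximalRealSubfield L)) L (IsCMField.complexConj L) 2 _ u) (by rw [hfin]; exact hx)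
  have e := ((mem_chiSectionSpace_iff _).1 hφV).2 y ⟨_, hb⟩
  have hgoal : φ (y * u) = φ (y * finAdelicToAdelic (↥(maximalRealSubfield L)) L (IsCMField.complexConj L) 2 _ (finPart (↥(maximalRealSubfield L)) L (IsCMField.complexConj L) 2 _ u)) :=
    congrArg (fun v => φ (y * v)) hu'
  rw [hgoal]
  exact e.trans (by rw [hω, one_mul])

/-! ## §2 HEAD: the decay letter `hdec′` at a general level, hypothesis-first on the archimedean LINE SYMBOL of `φ′` -/

/-- **THE DECAY LETTER `hdec′` AT A GENERAL LEVEL, ON THE LINE-SYMBOL LETTER `hφsym`.**  For a unitary Hecke character `χ` of `L`, `T ≥ 1`, a continuous bounded section `φ′ ∈ V(χ, K′, ω)`, an open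
compact `U₀ ≤ GL₂(𝒪̂_L)` with `ι_f(U₀ ∩ G_f) ⊆ K′` on which `ω = 1`, and the ARCHIMEDEAN LINE SYMBOL of `φ′` (★ `K2E1KFiniteArchSmoothU2`'s socket `hφsym`, `m = [L⁺:ℚ] + 1`; at M1 it is ★
`lineSymbol_of_archConstant` ∘ ★ `apply_eq_of_finPart_eq`, for a general `(χ_∞, τ)` it is the product-angular leaf of ★ `lineSymbol_of_prod_angular` — NOT proved here): for every `z′` with `1 < Re z′`
there is `M₁` with `‖E(f′_{z′})(g) − E_B(f′_{z′})(g)‖ ≤ M₁` whenever `H(g) > T` (★ p857911 with `hφB`, `hf`, `hφU` discharged and `hφarch` from `hφsym` by ★ `exists_archSmooth_flatSectionU_of_lineSymbol_cm_two`).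
[cite: MoeglinWaldspurger1995, I.2.13, II.1.7] [cite: Garrett2018, §2.10] -/
theorem hdec'_level_cm_two_of_lineSymbol
    [MeasurableSpace (quasiSplit (↥(maximalRealSubfield L)) L (IsCMField.complexConj L) 2).Adelic] [BorelSpace (quasiSplit (↥(maximalRealSubfield L)) L (IsCMField.complexConj L) 2).Adelic]
    (ν : Measure ↥(adelicUnipotent ↥(maximalRealSubfield L) L (IsCMField.complexConj L) 2)) [ν.IsHaarMeasure]
    {𝓕 : Set ↥(adelicUnipotent ↥(maximalRealSubfield L) L (IsCMField.complexConj L) 2)}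
    (h𝓕N : IsFundamentalDomain ↥(rationalUnipotent ↥(maximalRealSubfield L) L (IsCMField.complexConj L) 2) 𝓕 ν) (h𝓕c : IsCompact (closure 𝓕))
    {T : ℝ≥0} (hT : 1 ≤ T) {χ : HeckeCharacter L} (hχ : χ.IsUnitary)
    {K' : Subgroup (quasiSplit (↥(maximalRealSubfield L)) L (IsCMField.complexConj L) 2).Adelic} {ωK : ↥K' → ℂ}
    {φ : (quasiSplit (↥(maximalRealSubfield L)) L (IsCMField.complexConj L) 2).Adelic → ℂ} (hφ'V : φ ∈ chiSectionSpace χ K' ωK) (hφ'c : Continuous φ) {Cφ0 : ℝ} (hφ'C : ∀ x, ‖φ x‖ ≤ Cφ0)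
    (U₀ : Subgroup (GL (Fin 2) (FiniteAdeleRing (𝓞 L) L))) (hU₀o : IsOpen (U₀ : Set (GL (Fin 2) (FiniteAdeleRing (𝓞 L) L)))) (hU₀K : U₀ ≤ glFiniteIntegralLevel 2 L)
    (hU : ∀ b : finAdelic (↥(maximalRealSubfield L)) L (IsCMField.complexConj L) 2 ((StdForm.antidiagonal 2).over L), (b : GL (Fin 2) (FiniteAdeleRing (𝓞 L) L)) ∈ U₀ →
      ∃ hb : finAdelicToAdelic (↥(maximalRealSubfield L)) L (IsCMField.complexConj L) 2 ((StdForm.antidiagonal 2).over L) b ∈ K', ωK ⟨_, hb⟩ = 1)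
    -- the line-symbol letter (δ, m fixed by the caller; `m = [L⁺:ℚ] + 1` is what ★ p857911 needs)
    {δ : L} (hcδ : IsCMField.complexConj L δ = -δ) (hδ : δ ≠ 0) {Mφ : ℝ} (hMφ : 0 ≤ Mφ) {m : ℕ} (hm : (finrank ℚ ↥(maximalRealSubfield L) : ℝ) < m)
    (hφsym : ∀ k ∈ ((standardMaximalCompactGL 2 L).comap (adelicVal ↥(maximalRealSubfield L) L (IsCMField.complexConj L) 2 ((StdForm.antidiagonal 2).over L)) : Subgroup (quasiSplit (↥(maximalRealSubfield L)) L (IsCMField.complexConj L) 2).Adelic), ∀ b : FiniteAdeleRing (𝓞 ↥(maximalRealSubfield L)) ↥(maximalRealSubfield L),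
      ContDiff ℝ m ((fun a : InfiniteAdeleRing ↥(maximalRealSubfield L) => φ (((quasiSplit (↥(maximalRealSubfield L)) L (IsCMField.complexConj L) 2).toAdelic (weylLongU ((IsCMField.complexConj L : L ≃ₐ[↥(maximalRealSubfield L)] L) : L →+* L) (rfl : ((StdForm.antidiagonal 2).over L) = ((StdForm.antidiagonal 2).over L)))) *
          ((middleRootUnipotent hij hN (Multiplicative.ofAdd (traceZeroLine ↥(maximalRealSubfield L) L (IsCMField.complexConj L) hcδ hδ ((a, b) : AdeleRing (𝓞 ↥(maximalRealSubfield L)) ↥(maximalRealSubfield L)))) : ↥(adelicUnipotent ↥(maximalRealSubfield L) L (IsCMField.complexConj L) 2)) : (quasiSplit (↥(maximalRealSubfield L)) L (IsCMField.complexConj L) 2).Adelic) * k)) ∘ (InfiniteAdeleRing.ringEquiv_mixedSpace ↥(maximalRealSubfield L)).symm) ∧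
      ∀ j : ℕ, j ≤ m → ∀ s : mixedSpace ↥(maximalRealSubfield L), ‖iteratedFDeriv ℝ j ((fun a : InfiniteAdeleRing ↥(maximalRealSubfield L) => φ (((quasiSplit (↥(maximalRealSubfield L)) L (IsCMField.complexConj L) 2).toAdelic (weylLongU ((IsCMField.complexConj L : L ≃ₐ[↥(maximalRealSubfield L)] L) : L →+* L) (rfl : ((StdForm.antidiagonal 2).over L) = ((StdForm.antidiagonal 2).over L)))) *
          ((middleRootUnipotent hij hN (Multiplicative.ofAdd (traceZeroLine ↥(maximalRealSubfield L) L (IsCMField.complexConj L) hcδ hδ ((a, b) : AdeleRing (𝓞 ↥(maximalRealSubfield L)) ↥(maximalRealSubfield L)))) : ↥(adelicUnipotent ↥(maximalRealSubfield L) L (IsCMField.complexConj L) 2)) : (quasiSplit (↥(maximalRealSubfield L)) L (IsCMField.complexConj L) 2).Adelic) * k)) ∘ (InfiniteAdeleRing.ringEquiv_mixedSpace ↥(maximalRealSubfield L)).symm) s‖ ≤ Mφ) :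
    ∀ z' : ℂ, 1 < z'.re → ∃ M₁ : ℝ, ∀ g : (quasiSplit (↥(maximalRealSubfield L)) L (IsCMField.complexConj L) 2).Adelic, T < borelHeight g →
      ‖eisensteinSeriesU (flatSectionU φ z') g - borelConstantTerm ν 𝓕 (eisensteinSeriesU (flatSectionU φ z')) g‖ ≤ M₁ := by
  intro z' hz'
  -- auxiliary structures (not in the statement): Borel structures and additive Haar measures of `𝔸_{L⁺}`, `𝔸_{L⁺,∞}`, `𝔸_{L⁺,f}`
  letI : MeasurableSpace (AdeleRing (𝓞 L) L) := borel _
  haveI : BorelSpace (AdeleRing (𝓞 L) L) := ⟨rfl⟩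
  letI : MeasurableSpace (AdeleRing (𝓞 ↥(maximalRealSubfield L)) ↥(maximalRealSubfield L)) := borel _
  haveI : BorelSpace (AdeleRing (𝓞 ↥(maximalRealSubfield L)) ↥(maximalRealSubfield L)) := ⟨rfl⟩
  letI : MeasurableSpace (InfiniteAdeleRing ↥(maximalRealSubfield L)) := borel _
  haveI : BorelSpace (InfiniteAdeleRing ↥(maximalRealSubfield L)) := ⟨rfl⟩
  letI : MeasurableSpace (FiniteAdeleRing (𝓞 ↥(maximalRealSubfield L)) ↥(maximalRealSubfield L)) := borel _
  haveI : BorelSpace (FiniteAdeleRing (𝓞 ↥(maximalRealSubfield L)) ↥(maximalRealSubfield L)) := ⟨rfl⟩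
  haveI := locallyCompactSpace_adeleRing' ↥(maximalRealSubfield L)
  haveI := locallyCompactSpace_finiteAdeleRing' ↥(maximalRealSubfield L)
  -- `hφarch` from the line-symbol letter (★ `exists_archSmooth_flatSectionU_of_lineSymbol_cm_two`)
  obtain ⟨Cφ, hCφ, hφarch⟩ := exists_archSmooth_flatSectionU_of_lineSymbol_cm_two L hij hN hcδ hδ z' m hMφ hφsym
  exact exists_bound_sub_borelConstantTerm_level_cm_two_of_archSmooth L hij hN hcδ hδ ν h𝓕N h𝓕c
    (Measure.addHaar : Measure (AdeleRing (𝓞 ↥(maximalRealSubfield L)) ↥(maximalRealSubfield L))) (Measure.addHaar : Measure (InfiniteAdeleRing ↥(maximalRealSubfield L)))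
    (Measure.addHaar : Measure (FiniteAdeleRing (𝓞 ↥(maximalRealSubfield L)) ↥(maximalRealSubfield L))) χ hχ hz' hφ'c hφ'C (isChiSection_of_mem hφ'V).toAdelic_mul
    ((isChiSection_of_mem hφ'V).borelLaw_flatSectionU z') hU₀o hU₀K (apply_mul_eq_of_mem_map_ofFinite L hφ'V U₀ hU) hT (m := m) hm hCφ hφarch

/-- **`hdec` AT A GENERAL LEVEL** in the `σ1` byte shape (`∀ T ≥ 1, ∀ z′, 1 < Re z′ → ∃ M₁, …`), on the same line-symbol letter. [cite: MoeglinWaldspurger1995, I.2.13, II.1.7] -/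
theorem hdec_level_cm_two_of_lineSymbol
    [MeasurableSpace (quasiSplit (↥(maximalRealSubfield L)) L (IsCMField.complexConj L) 2).Adelic] [BorelSpace (quasiSplit (↥(maximalRealSubfield L)) L (IsCMField.complexConj L) 2).Adelic]
    (ν : Measure ↥(adelicUnipotent ↥(maximalRealSubfield L) L (IsCMField.complexConj L) 2)) [ν.IsHaarMeasure]
    {𝓕 : Set ↥(adelicUnipotent ↥(maximalRealSubfield L) L (IsCMField.complexConj L) 2)}
    (h𝓕N : IsFundamentalDomain ↥(rationalUnipotent ↥(maximalRealSubfield L) L (IsCMField.complexConj L) 2) 𝓕 ν) (h𝓕c : IsCompact (closure 𝓕))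
    {χ : HeckeCharacter L} (hχ : χ.IsUnitary)
    {K' : Subgroup (quasiSplit (↥(maximalRealSubfield L)) L (IsCMField.complexConj L) 2).Adelic} {ωK : ↥K' → ℂ}
    {φ : (quasiSplit (↥(maximalRealSubfield L)) L (IsCMField.complexConj L) 2).Adelic → ℂ} (hφ'V : φ ∈ chiSectionSpace χ K' ωK) (hφ'c : Continuous φ) {Cφ0 : ℝ} (hφ'C : ∀ x, ‖φ x‖ ≤ Cφ0)
    (U₀ : Subgroup (GL (Fin 2) (FiniteAdeleRing (𝓞 L) L))) (hU₀o : IsOpen (U₀ : Set (GL (Fin 2) (FiniteAdeleRing (𝓞 L) L)))) (hU₀K : U₀ ≤ glFiniteIntegralLevel 2 L)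
    (hU : ∀ b : finAdelic (↥(maximalRealSubfield L)) L (IsCMField.complexConj L) 2 ((StdForm.antidiagonal 2).over L), (b : GL (Fin 2) (FiniteAdeleRing (𝓞 L) L)) ∈ U₀ →
      ∃ hb : finAdelicToAdelic (↥(maximalRealSubfield L)) L (IsCMField.complexConj L) 2 ((StdForm.antidiagonal 2).over L) b ∈ K', ωK ⟨_, hb⟩ = 1)
    {δ : L} (hcδ : IsCMField.complexConj L δ = -δ) (hδ : δ ≠ 0) {Mφ : ℝ} (hMφ : 0 ≤ Mφ) {m : ℕ} (hm : (finrank ℚ ↥(maximalRealSubfield L) : ℝ) < m)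
    (hφsym : ∀ k ∈ ((standardMaximalCompactGL 2 L).comap (adelicVal ↥(maximalRealSubfield L) L (IsCMField.complexConj L) 2 ((StdForm.antidiagonal 2).over L)) : Subgroup (quasiSplit (↥(maximalRealSubfield L)) L (IsCMField.complexConj L) 2).Adelic), ∀ b : FiniteAdeleRing (𝓞 ↥(maximalRealSubfield L)) ↥(maximalRealSubfield L),
      ContDiff ℝ m ((fun a : InfiniteAdeleRing ↥(maximalRealSubfield L) => φ (((quasiSplit (↥(maximalRealSubfield L)) L (IsCMField.complexConj L) 2).toAdelic (weylLongU ((IsCMField.complexConj L : L ≃ₐ[↥(maximalRealSubfield L)] L) : L →+* L) (rfl : ((StdForm.antidiagonal 2).over L) = ((StdForm.antidiagonal 2).over L)))) *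
          ((middleRootUnipotent hij hN (Multiplicative.ofAdd (traceZeroLine ↥(maximalRealSubfield L) L (IsCMField.complexConj L) hcδ hδ ((a, b) : AdeleRing (𝓞 ↥(maximalRealSubfield L)) ↥(maximalRealSubfield L)))) : ↥(adelicUnipotent ↥(maximalRealSubfield L) L (IsCMField.complexConj L) 2)) : (quasiSplit (↥(maximalRealSubfield L)) L (IsCMField.complexConj L) 2).Adelic) * k)) ∘ (InfiniteAdeleRing.ringEquiv_mixedSpace ↥(maximalRealSubfield L)).symm) ∧
      ∀ j : ℕ, j ≤ m → ∀ s : mixedSpace ↥(maximalRealSubfield L), ‖iteratedFDeriv ℝ j ((fun a : InfiniteAdeleRing ↥(maximalRealSubfield L) => φ (((quasiSplit (↥(maximalRealSubfield L)) L (IsCMField.complexConj L) 2).toAdelic (weylLongU ((IsCMField.complexConj L : L ≃ₐ[↥(maximalRealSubfield L)] L) : L →+* L) (rfl : ((StdForm.antidiagonal 2).over L) = ((StdForm.antidiagonal 2).over L)))) *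
          ((middleRootUnipotent hij hN (Multiplicative.ofAdd (traceZeroLine ↥(maximalRealSubfield L) L (IsCMField.complexConj L) hcδ hδ ((a, b) : AdeleRing (𝓞 ↥(maximalRealSubfield L)) ↥(maximalRealSubfield L)))) : ↥(adelicUnipotent ↥(maximalRealSubfield L) L (IsCMField.complexConj L) 2)) : (quasiSplit (↥(maximalRealSubfield L)) L (IsCMField.complexConj L) 2).Adelic) * k)) ∘ (InfiniteAdeleRing.ringEquiv_mixedSpace ↥(maximalRealSubfield L)).symm) s‖ ≤ Mφ) :
    ∀ T : ℝ≥0, 1 ≤ T → ∀ z' : ℂ, 1 < z'.re → ∃ M₁ : ℝ, ∀ g : (quasiSplit (↥(maximalRealSubfield L)) L (IsCMField.complexConj L) 2).Adelic, T < borelHeight g →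
      ‖eisensteinSeriesU (flatSectionU φ z') g - borelConstantTerm ν 𝓕 (eisensteinSeriesU (flatSectionU φ z')) g‖ ≤ M₁ :=
  fun _ hT z' hz' => hdec'_level_cm_two_of_lineSymbol L hij hN ν h𝓕N h𝓕c hT hχ hφ'V hφ'c hφ'C U₀ hU₀o hU₀K hU hcδ hδ hMφ hm hφsym z' hz'

end Summit.HodgeConjecture.HodgeConjecture.Cruxes.H413.K2E1ChiMaassSelbergDecayLetterLevelCMTwo
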